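import Summits.BirchSwinnertonDyer.Rank1Residual.Additive.N11KimAtThreePUB
import Summits.BirchSwinnertonDyer.Rank1Residual.Additive.X4ThreeKuriharaCertKernel
import Summits.BirchSwinnertonDyer.Rank1Residual.Additive.X4ThreeKuriharaCertKernelPsi3
import Summits.BirchSwinnertonDyer.Rank1Residual.Additive.IntModelTamagawaCertificateLocal
import Summits.BirchSwinnertonDyer.Rank1Residual.GaloisImage.ThreeAdicFrobeniusWitness
import Summits.BirchSwinnertonDyer.Rank1Residual.GaloisImage.LocalThreeTorsionDecider
import Summits.BirchSwinnertonDyer.Rank1Residual.X11b.ChaPairsMinimality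
import Summits.BirchSwinnertonDyer.Rank1Residual.X11b.KrausMinimalityGeneralTwo
import HarnessLib

/-!
# Route `KatoDescentPotSupersingular` (rung K9): child crux `WildLowerIntrinsicNonCM` (item
# stmt-BirchSwinnertonDyer-19663), stub `stub_intr_kimRows` — the FIRST WILD per-row RECORD on the REFEREED
# Kim-at-3 leaf: `26217a1` (`N = 26217 = 3³·971`, Kodaira `II*` at `3`, `#Ш_an = 9`, `∏ c_ℓ = 2`), every
# curve-side binder IN THE KERNEL, the Kolyvagin level `6283 = 61·103` named by TWO engines, its Kurihara VALUE
# the evidence binder (a `--supports … --as helper` file; seat `bsd-potss-k9-kur3`, generation 0)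

HONEST FRAMING. A PER-PAIR record, not a class theorem: `BSD(E,3) ∧ MissingPPartAt W 3` for ONE curve,
CONDITIONAL on rung W2's leaf `N11.KimAtThreeRankZeroPUB` (explicit hypothesis `hKim`; a refereed CELL memo
of `bsd-addord`, NOT a Literature fact), on GZK, modularity, Agashe–Ribet–Stein Thm. 2.6 (`h26`), and on
three per-pair EVIDENCE binders the kernel cannot fill: `r_an = 0` (`hr`), the OPTIMAL datum at level
`26217` (`D`, `hopt`; Cremona: the class `26217a` is a single curve), and the Kurihara VALUE
`hδ : ∃ ψ, δ̃_{6283} ≢ 0 (mod 3)`. The item 19663 / the stub stay OPEN (class-wide = Kurihara's conjecture);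
nothing is booked; BSD is not proved by any of this.

THE ROW (k9-c2 g4 ledger v5: intrinsic X4, `t0|v3Tam=0|jw|NO-CYCLIC-LEVEL-TRIED` — no cyclic pair level
`≤ 2000` in the census kit j253199). THIS SEAT'S HARVEST (kit j256224 pilot = j256807 full, scripts
`compute/k9kur3/` sha16 kur3.py 16e1c2237ca61163 / exact3.gp 1196d7e5b5b629d3): the smallest cyclic pair
level is `6283 = 61·103`; engine C3 (k9-c2 engine C core: numerical symbols, exact rounding with common
denominator `2`, `0/60` Hecke failures) gives `δ̃_{6283} ≡ 1 (mod 3)` — a UNIT; the EXACT engine recomputed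
the level BLIND in BOTH modes (PARI `msfromell` direct, calibration `ρ = 1`; and read on the `−3`-twist
`[0,0,1,−255,1728]` of conductor `26217`, calibration `c = 1`, 14/14 consistency points): `δ̃_{6283} ≡ 1`
twice, symbol tables `6120/6120` identical; `ν = 1` numbers `δ̃_{61} ≡ δ̃_{103} ≡ 0`.

IN THE KERNEL (team n1011's record tools, `decide` on Cremona's coefficients `[0, 0, 1, −2295, −46663]`):
`Δ ≠ 0`; global minimality (bounded Kraus form); surj(3) from two Frobenius witnesses (`ℓ = 7`: irreducible
characteristic polynomial mod `3`; `ℓ = 103`: order `3`) and the `3`-adic TOWER from the Frobenius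
certificate `ℓ = 11` (`11 ≡ 2 (mod 9)`, `a₁₁ = 6`); `#E(ℚ₃)[3] = 1` by the `LocalThreeTorsionDecider`
(n1011-p17; certificate `k = 5`, one `Ψ₃`-root ball `(16704, 4, 9, 3)` with a NON-square `g`-value);
`61, 103 ∈ 𝒫₁(E,3)` from the point counts `63`, `105`; cyclicity `#Ẽ(𝔽_ℓ)[3] ≤ 3` at `103` by the count
(`9 ∤ 105`) and at `61` by the single `Ψ₃`-root `3 mod 61` (`9 ∣ 63`); `∏ c_ℓ = 2` by the rank-2
observatory's Tamagawa certificates (`3`: `II*`, `c = 1`; `971`: `I₂` non-split, `c = 2`). The record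
kernel is this seat's `KimRowsHarvest.bsdp_three_wild_of_optimal_of_towerSurj_of_t0_of_kuriharaUnitAt`
(sibling file `…WildLowerKimRowsHarvest.lean`; the refereed-leaf twin of n1011's T-a2-REC unit-row shape;
NO reduction-type input), inlined here so that the two files land independently.

References: [Kim2025RefinedTNC] Thm. 1.1, Thm. 1.2; [Kim2022StructureSelmer] §1.2.2, §1.4.3, Thm. 1.10;
[AgasheRibetStein2006] Thm. 2.6; [SerreAbelianLadic1968] IV §3.4 Lemma 3; [Serre1972] §2.4 Prop. 15;
[SilvermanAEC2009] III.2.3, VII.1, VII.5; [Silverman1994] IV.9.4; [Kraus1989] Prop. 2; [Miller2011LMS]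
Def. 1.1; Cremona's tables [Cremona1997]; generator `b2b-bsdres-n1011-p03/tools/rowgen.py` (curve-side blocks).
-/

set_option autoImplicit false
-- sibling precedent (`KatoDescentPotSupersingularAssembly.lean`): the directory name repeats the summit name
set_option linter.dupNamespace false

noncomputable section

open scoped Classical

open WeierstrassCurve Literature.NumberTheory.EllipticCurves
  Literature.NumberTheory.EllipticCurves.ModularForms
  Literature.NumberTheory.EllipticCurves.Rank1Residual
  Literature.NumberTheory.EllipticCurves.Rank1Residual.Typed
  Literature.NumberTheory.EllipticCurves.AgasheRibetStein2006
  Literature.NumberTheory.EllipticCurves.Rank1Residual.X11RankOneCertificates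
  Summit.BirchSwinnertonDyer.BirchSwinnertonDyer.Rank1Residual.IntModel
  Summit.BirchSwinnertonDyer.BirchSwinnertonDyer.Rank1Residual.X11RankOne
  Summit.BirchSwinnertonDyer.Rank1Residual.GaloisImage
  Summit.BirchSwinnertonDyer.Rank1Residual
  Summit.BirchSwinnertonDyer.Rank1Residual.Additive
  Summit.BirchSwinnertonDyer.Rank1Residual.X4

namespace Summit.BirchSwinnertonDyer.BirchSwinnertonDyer.Theorems.KimRowsHarvest

/-! ### Record: `26217a1` (`N = 26217`) -/

/-- `#Ẽ(𝔽_{7}) = 5` for Cremona's model `26217a1 = [0, 0, 1, -2295, -46663]` (`a = 3`: surj(3) witness, irreducible characteristic polynomial mod `3`). [folklore] -/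
theorem card_v26217a1_7 :
    Nat.card (((⟨0, 0, 1, -2295, -46663⟩ : WeierstrassCurve ℤ).map
      (Int.castRingHom (ZMod 7))).toAffine.Point) = 5 := by
  rw [@WeierstrassCurve.natCard_point_eq_one_add_card (ZMod 7) (@ZMod.instField 7 ⟨by norm_num⟩) _ _ _
    (by decide +kernel), @card_sol_eq_sum_euler (ZMod 7) (@ZMod.instField 7 ⟨by norm_num⟩) _ _
    (by rw [ZMod.ringChar_zmod_n]; decide), ZMod.card]
  decide +kernel

/-- `#Ẽ(𝔽_{103}) = 105` for Cremona's model `26217a1 = [0, 0, 1, -2295, -46663]` (`a = -1`: surj(3) witness, Frobenius of order `3`). [folklore] -/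
theorem card_v26217a1_103 :
    Nat.card (((⟨0, 0, 1, -2295, -46663⟩ : WeierstrassCurve ℤ).map
      (Int.castRingHom (ZMod 103))).toAffine.Point) = 105 := by
  rw [@WeierstrassCurve.natCard_point_eq_one_add_card (ZMod 103) (@ZMod.instField 103 ⟨by norm_num⟩) _ _ _
    (by decide +kernel), @card_sol_eq_sum_euler (ZMod 103) (@ZMod.instField 103 ⟨by norm_num⟩) _ _
    (by rw [ZMod.ringChar_zmod_n]; decide), ZMod.card]
  decide +kernel

/-- `#Ẽ(𝔽_{11}) = 6` for Cremona's model `26217a1 = [0, 0, 1, -2295, -46663]` (`a = 6`: tower certificate `11 ≡ 2 (mod 9)`, `a ≡ 6 (mod 9)`). [folklore] -/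
theorem card_v26217a1_11 :
    Nat.card (((⟨0, 0, 1, -2295, -46663⟩ : WeierstrassCurve ℤ).map
      (Int.castRingHom (ZMod 11))).toAffine.Point) = 6 := by
  rw [@WeierstrassCurve.natCard_point_eq_one_add_card (ZMod 11) (@ZMod.instField 11 ⟨by norm_num⟩) _ _ _
    (by decide +kernel), @card_sol_eq_sum_euler (ZMod 11) (@ZMod.instField 11 ⟨by norm_num⟩) _ _
    (by rw [ZMod.ringChar_zmod_n]; decide), ZMod.card]
  decide +kernel

/-- `#Ẽ(𝔽_{61}) = 63` for Cremona's model `26217a1 = [0, 0, 1, -2295, -46663]` (Kolyvagin prime of the level (`𝒫_1`): `61 ≡ 1 (mod 3)`, `3 ∣ 63`, `9 ∣ 63`: cyclicity by the single `Ψ₃`-root `3 mod 61`). [folklore] -/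
theorem card_v26217a1_61 :
    Nat.card (((⟨0, 0, 1, -2295, -46663⟩ : WeierstrassCurve ℤ).map
      (Int.castRingHom (ZMod 61))).toAffine.Point) = 63 := by
  rw [@WeierstrassCurve.natCard_point_eq_one_add_card (ZMod 61) (@ZMod.instField 61 ⟨by norm_num⟩) _ _ _
    (by decide +kernel), @card_sol_eq_sum_euler (ZMod 61) (@ZMod.instField 61 ⟨by norm_num⟩) _ _
    (by rw [ZMod.ringChar_zmod_n]; decide), ZMod.card]
  decide +kernel

/-- **`ρ̄_{E,3}` onto for `26217a1`**, in the kernel (`ℓ₁ = 7`, `a = 3`: irreducible mod `3`; `ℓ₂ = 103`,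
`a = -1 ≡ 2`, `#Ẽ = 105`, `9 ∤ 105`). [cite: Serre1972, §2.4 Prop. 15] -/
theorem surj3_v26217a1 {W : WeierstrassCurve ℚ} [W.IsElliptic] [W.IsGloballyMinimal]
    (hI : integralModelInt W = ⟨0, 0, 1, -2295, -46663⟩) : W.HasSurjectiveModNGaloisRep 3 :=
  @hasSurjectiveModNGaloisRep_of_intModel_of_irr_of_order W _ _ _ hI 3 ⟨by norm_num⟩ 7 103 ⟨by norm_num⟩
    ⟨by norm_num⟩ (by norm_num) (by norm_num) (by decide +kernel) (by decide +kernel) _ _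
    card_v26217a1_7 card_v26217a1_103 (by decide) (by decide) (by decide) (by decide)

/-- **`ρ̄_{E,3^n}` onto for every `n`, for `26217a1`** (Frobenius certificate `ℓ = 11`).
[cite: SerreAbelianLadic1968, Ch. IV §3.4, Lemma 3 (IV-23)] [cite: Elkies2006, Introduction (p. 1) and §1] -/
theorem towerSurj3_v26217a1 {W : WeierstrassCurve ℚ} [W.IsElliptic] [W.IsGloballyMinimal]
    (hI : integralModelInt W = ⟨0, 0, 1, -2295, -46663⟩) (n : ℕ) :
    W.HasSurjectiveModNGaloisRep (3 ^ n : ℕ) :=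
  @forall_hasSurjectiveModNGaloisRep_three_pow_of_intModel_of_frobenius W _ _ _ hI (surj3_v26217a1 hI)
    11 ⟨by norm_num⟩ (by decide +kernel) _ card_v26217a1_11 (by decide) (by decide) n

/-- Row certificate of the Tamagawa product of `26217a1 = [0, 0, 1, -2295, -46663]`: `3`: `II*`, `c = 1` (exact by type); `971`: `I2`, `c = 2` (non-split) — the rank-2
observatory's `TamLocal`/`TamX`/`TamZ` certificates (Tate's algorithm, `decide +kernel`; engine 1 = `kernel-tam3/engine1`
reused via the seat tool `tools/tamcert.py`; Cremona's table: `∏ c_ℓ = 2`). [cite: Silverman1994, IV.9.4] [cite: CremonaAlgorithms1997, Table 1] -/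
theorem tamRow_v26217a1 :
    Summit.BirchSwinnertonDyer.BirchSwinnertonDyer.Rank2Observatory.Tam.TamZ.rowCheckZ
      [⟨3, 1, 5, 0, 3, 0, 13, 11, 10, 0, 1⟩, ⟨971, 31, 3, 0, 0, 0, 0, 2, 0, 0, 2⟩]
      [] []
      ⟨0, 0, 1, -2295, -46663⟩ = true := by
  decide +kernel

/-- **`∏_ℓ c_ℓ (26217a1) = 2` IN THE KERNEL** for any globally minimal `W / ℚ` with this integral model.
[cite: Silverman1994, IV.9.4] [cite: CremonaAlgorithms1997, Table 1] -/
theorem tamagawaProduct_v26217a1 {W : WeierstrassCurve ℚ} [W.IsGloballyMinimal]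
    (hI : integralModelInt W = ⟨0, 0, 1, -2295, -46663⟩) : W.tamagawaProduct = 2 :=
  (IntModelTam.tamagawaProduct_eq_rowValueZ_of_intModel hI tamRow_v26217a1 (by decide +kernel)).trans
    (by decide +kernel)

/-- **`#E(ℚ₃)[3] = 1` for `26217a1`** (`t = 0`: Kim's (t0) binder of the refereed leaf) by the kernel decider
`LocalThreeTorsionDecider` (n1011-p17): certificate `k = 5`, one `Ψ₃`-root ball `(16704, 4, 9, 3)` whose
`g`-value is a NON-square, so no `3`-torsion point is defined over `ℚ₃`. [folklore] -/
theorem natCard_threeTorsion_v26217a1 (W : WeierstrassCurve ℚ) [W.IsElliptic] [W.IsGloballyMinimal]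
    (hI : W.integralModelInt = ⟨0, 0, 1, -2295, -46663⟩) :
    Nat.card {Q : (W.baseChange ℚ_[3]).toAffine.Point // (3 : ℕ) • Q = 0} = 1 :=
  (LocalTorsion3.natCard_threeTorsion_eq_three_pow_zero_of_intModel_of_check 0 0 1 (-2295) (-46663) W hI
    (k := 5) (cert := [((16704 : ℤ), 4, 9, 3)]) (by decide +kernel)).trans (pow_zero 3)

/-- **`BSD(E,3)` for `26217a1` on the REFEREED leaf, LEVEL SLOT OPEN** (`N = 26217`; Cremona's minimal model
`[0, 0, 1, -2295, -46663]`, any globally minimal elliptic `W` with this integral model; the `3`-adic tower,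
`#E(ℚ₃)[3] = 1` and `∏ c_ℓ = 2` IN THE KERNEL). Per-pair binders: `r_an = 0`, optimal datum at level
`26217 ≤ 130000` (Agashe–Ribet–Stein Thm. 2.6 `h26`); LEVEL SLOT: a cyclic `n ∈ 𝒩₁(E,3)` with `δ̃_n ≢ 0
(mod 3)`. CONDITIONAL on `N11.KimAtThreeRankZeroPUB` (`hKim`). Per pair; nothing booked.
[cite: Kim2025RefinedTNC, Thm. 1.1 ("BSD") and Thm. 1.2 (rk 0) (PDF pp. 5–6)]
[cite: AgasheRibetStein2006, Thm. 2.6 (p. 619)] [cite: Miller2011LMS, §1 and Def. 1.1] -/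
theorem bsdp3_kim_v26217a1_of_level
    (hKim : N11.KimAtThreeRankZeroPUB)
    (hGZK : rank_eq_analyticRank_of_analyticRank_le_one) (hmod : hasEntireLFunction_rat)
    (h26 : cremona_abs_maninConstant_eq_one_of_level_le)
    {W : WeierstrassCurve ℚ} [W.IsElliptic] [W.IsGloballyMinimal]
    (hI : integralModelInt W = ⟨0, 0, 1, -2295, -46663⟩)
    (hr : W.analyticRank = 0)
    (D : ModularParametrizationData W 26217)
    (hopt : ∀ z ∈ D.L.lattice, ∃ w ∈ periodLattice D.f, z = D.c * w)
    (n : ℕ) [NeZero n] (hn : Kato.IsKolyvaginProduct W 3 1 n)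
    (hcyc : ∀ (ℓ : ℕ) [Fact ℓ.Prime], ℓ ∣ n →
      Nat.card {P : ((WeierstrassCurve.integralModelInt W).map
          (Int.castRingHom (ZMod ℓ))).toAffine.Point // 3 • P = 0} ≤ 3)
    (hδ : ∃ ψ : (ℓ : ℕ) → (ZMod ℓ)ˣ →* Multiplicative (ZMod (3 ^ 1)),
      (∀ ℓ ∈ n.primeFactors, Function.Surjective (ψ ℓ)) ∧ kuriharaNumber D.f (3 ^ 1) n ψ ≠ 0) :
    haveI : Fact (Nat.Prime 3) := ⟨Nat.prime_three⟩
    BSDp W 3 ∧ MissingPPartAt W 3 := by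
  haveI : Fact (Nat.Prime 3) := ⟨Nat.prime_three⟩
  -- the refereed-leaf record kernel (`KimRowsHarvest.bsdp_three_wild_of_optimal_of_towerSurj_of_t0_of_kuriharaUnitAt`
  -- of the sibling file `…WildLowerKimRowsHarvest.lean`), inlined so that the two files land independently
  have hc : ¬ (3 : ℤ) ∣ D.maninConstant :=
    not_dvd_maninConstant_of_level_le h26 W D hopt (by norm_num) Nat.prime_three
  have hper : ∃ u : ℚ, ‖(u : ℚ_[3])‖ = 1 ∧ W.realPeriodRat = u * plusPeriod D.f :=
    X4.periodTransfer_of_optimal 3 D hopt hc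
  have hL : W.entireLFunction 1 ≠ 0 := (W.analyticRank_eq_zero_iff_holds (hmod W)).mp hr
  have htam : ¬ 3 ∣ W.tamagawaProduct := by rw [tamagawaProduct_v26217a1 hI]; decide
  have hB : BSDp W 3 :=
    N11.bsdp_three_of_kimAtThreeRankZeroPUB_of_kuriharaUnitAt W hKim hGZK (towerSurj3_v26217a1 hI)
      (natCard_threeTorsion_v26217a1 W hI) hL D hper htam (kuriharaUnitAt_of_level 3 D.f n hn hcyc hδ)
  haveI : Finite W.sha := (hGZK W (by rw [hr]; exact zero_le_one)).2
  exact ⟨hB, missingPPartAt_of_bsdp W 3 hB⟩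

/-- **`BSD(E,3)` for `26217a1` at the level `n = 61·103 = 6283` on the REFEREED leaf**, on the LITERAL model
`W = [0, 0, 1, -2295, -46663]`: `Δ ≠ 0`, minimality, `61, 103 ∈ 𝒫₁(E,3)` (kernel point counts `63`, `105`),
cyclicity (`Ψ₃`-root `3 mod 61`; count at `103`), the tower, `#E(ℚ₃)[3] = 1`, `∏ c_ℓ = 2` — all IN THE
KERNEL; the VALUE `δ̃_{6283} ≢ 0 (mod 3)` is the EVIDENCE binder `hδ` (two engines, three computations:
kit j256224 / j256807, engine C3 `≡ 1`, exact engine modes D and T `≡ 1`, tables 6120/6120 identical).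
CONDITIONAL on `N11.KimAtThreeRankZeroPUB` (`hKim`). Per pair; closes NOTHING.
[cite: Kim2025RefinedTNC, Thm. 1.1 ("BSD") and Thm. 1.2 (rk 0)] [cite: Kim2022StructureSelmer, §1.2.2 and Thm. 1.10 (1)]
[cite: AgasheRibetStein2006, Thm. 2.6 (p. 619)] [cite: SilvermanAEC2009, VII.1 Remark 1.1] [cite: Miller2011LMS, Def. 1.1] -/
theorem bsdp3_kim_v26217a1
    (hKim : N11.KimAtThreeRankZeroPUB)
    (hGZK : rank_eq_analyticRank_of_analyticRank_le_one) (hmod : hasEntireLFunction_rat)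
    (h26 : cremona_abs_maninConstant_eq_one_of_level_le)
    (W : WeierstrassCurve ℚ) (hW : W = ⟨0, 0, 1, -2295, -46663⟩)
    (hr : W.analyticRank = 0)
    (D : ModularParametrizationData W 26217)
    (hopt : ∀ z ∈ D.L.lattice, ∃ w ∈ periodLattice D.f, z = D.c * w)
    (hδ : ∃ ψ : (ℓ : ℕ) → (ZMod ℓ)ˣ →* Multiplicative (ZMod (3 ^ 1)),
      (∀ ℓ ∈ (6283 : ℕ).primeFactors, Function.Surjective (ψ ℓ)) ∧
        kuriharaNumber D.f (3 ^ 1) 6283 ψ ≠ 0) :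
    haveI : Fact (Nat.Prime 3) := ⟨Nat.prime_three⟩
    BSDp W 3 ∧ MissingPPartAt W 3 := by
  subst hW
  haveI hE : (⟨0, 0, 1, -2295, -46663⟩ : WeierstrassCurve ℚ).IsElliptic :=
    X11b.isElliptic_of_discOf_ne_zero 0 0 1 (-2295) (-46663) (by decide +kernel)
  haveI hM : (⟨0, 0, 1, -2295, -46663⟩ : WeierstrassCurve ℚ).IsGloballyMinimal :=
    isGloballyMinimal_of_krausCriterion_bounded 0 0 1 (-2295) (-46663)
      (by decide +kernel) (by decide +kernel) (by decide +kernel)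
  have hI : integralModelInt (⟨0, 0, 1, -2295, -46663⟩ : WeierstrassCurve ℚ) =
      (⟨0, 0, 1, -2295, -46663⟩ : WeierstrassCurve ℤ) :=
    integralModelInt_eq_of_map_eq _ (map_mk_int 0 0 1 (-2295) (-46663))
  haveI : Fact (Nat.Prime 3) := ⟨Nat.prime_three⟩
  haveI : Fact (Nat.Prime 61) := ⟨by norm_num⟩
  haveI : Fact (Nat.Prime 103) := ⟨by norm_num⟩
  have h61 : Kato.IsKolyvaginPrime _ 3 1 61 :=
    isKolyvaginPrime_of_intModel_of_card hI 3 1 61 (by norm_num) (by decide +kernel) (by decide)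
      card_v26217a1_61 (by decide)
  have h103 : Kato.IsKolyvaginPrime _ 3 1 103 :=
    isKolyvaginPrime_of_intModel_of_card hI 3 1 103 (by norm_num) (by decide +kernel) (by decide)
      card_v26217a1_103 (by decide)
  have hn : Kato.IsKolyvaginProduct _ 3 1 (61 * 103) := isKolyvaginProduct_mul h61 h103 (by norm_num)
  exact bsdp3_kim_v26217a1_of_level hKim hGZK hmod h26 hI hr D hopt 6283 (by exact_mod_cast hn)
    (forall_card_torsion_le_of_dvd_mul 3 61 103
      (card_three_torsion_le_of_intModel_of_psi3_root hI 61 3 (by decide +kernel))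
      (card_torsion_le_of_intModel_of_card hI 3 103 card_v26217a1_103 (by decide))) hδ

/-- **L₀ (`MissingLowerBoundAt W 3`) for `26217a1` at the level `6283` on the REFEREED leaf** — the stub's
conclusion for this row, read off `bsdp3_kim_v26217a1`. Per pair; closes NOTHING.
[cite: Kim2025RefinedTNC, Thm. 1.2 (rk 0)] [cite: Miller2011LMS, Def. 1.1] -/
theorem missingLower3_kim_v26217a1
    (hKim : N11.KimAtThreeRankZeroPUB)
    (hGZK : rank_eq_analyticRank_of_analyticRank_le_one) (hmod : hasEntireLFunction_rat)
    (h26 : cremona_abs_maninConstant_eq_one_of_level_le)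
    (W : WeierstrassCurve ℚ) (hW : W = ⟨0, 0, 1, -2295, -46663⟩)
    (hr : W.analyticRank = 0)
    (D : ModularParametrizationData W 26217)
    (hopt : ∀ z ∈ D.L.lattice, ∃ w ∈ periodLattice D.f, z = D.c * w)
    (hδ : ∃ ψ : (ℓ : ℕ) → (ZMod ℓ)ˣ →* Multiplicative (ZMod (3 ^ 1)),
      (∀ ℓ ∈ (6283 : ℕ).primeFactors, Function.Surjective (ψ ℓ)) ∧
        kuriharaNumber D.f (3 ^ 1) 6283 ψ ≠ 0) :
    haveI : Fact (Nat.Prime 3) := ⟨Nat.prime_three⟩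
    MissingLowerBoundAt W 3 :=
  haveI : Fact (Nat.Prime 3) := ⟨Nat.prime_three⟩
  (lower_and_upper_of_missingPPartAt W 3 (bsdp3_kim_v26217a1 hKim hGZK hmod h26 W hW hr D hopt hδ).2).1

end Summit.BirchSwinnertonDyer.BirchSwinnertonDyer.Theorems.KimRowsHarvest

end
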